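import Literature.AlgebraicGeometry.Resolution.ResidueTranscendentalExtensions
import Literature.AlgebraicGeometry.Resolution.SeparatingElement
import Literature.AlgebraicGeometry.Resolution.HenselsLemmaProofs
import Literature.AlgebraicGeometry.Resolution.DefectlessResidueCharZero
import Mathlib.FieldTheory.PrimitiveElement
import HarnessLib

/-!
# Kuhlmann 2010, Lemma 5.5 (residue-transcendental case): proof from Hensel's Lemma and the statement of p. 19

Topic: `Literature/AlgebraicGeometry/Resolution` (valued function fields). PROVED assembly of the
named fact `Kuhlmann2010FiniteExtensionInertiallyGenerated` (`HenselizedFunctionFields.lean`: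
a finite extension `E` of a field `N` of the class `IsHenselizedInertiallyGeneratedRT V K` over
an algebraically closed `K` is again in the class) — Lemma 5.5 of F.-V. Kuhlmann, *Elimination
of ramification I*, Trans. AMS 362 (2010) = arXiv:1003.5678 as applied on p. 20 — from the
displayed statement of p. 19 (`Kuhlmann2010NoImmediateExtensionRT`, itself PROVED from the
earlier ingredients in `HenselizedFunctionFieldsImmediate.lean`) and Hensel's Lemma for henselian
valued fields (`Kuhlmann2010HenselsLemma`, `HenselLift.lean`), along the printed proof of
Lemma 5.5, Case II (p. 19):

> Case II) Suppose `F` contains a residue-transcendental element `x`. Since `vK(x) = vK` is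
> divisible and `vF/vK(x)` is finite, we have `vF = vK(x)`. Since `F̄|K(x)‾` is finite and
> `K(x)‾ = K̄(x̄)` is a function field of transcendence degree `1` over `K̄`, the same holds for
> `F̄`. Since `K̄` is algebraically closed, there is a separating transcendence basis `{ξ}` of
> `F̄|K̄`. We choose `x' ∈ F` such that `x̄' = ξ`. The henselian field `F` contains the
> henselization `K(x')^h`. Since `F̄|K̄(ξ)` is a finite separable extension, `F̄ = K̄(ξ,η)` for some
> `η` which is separable-algebraic over `K̄(ξ)`. Using Hensel's Lemma, we lift `η` to an element
> `y' ∈ F` such that the finite subextension `K(x')^h(y')|K(x')^h` of `F|K(x')^h` has the same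
> degree as `F̄|K̄(ξ)` and such that `K(x')^h(y')‾ = F̄`. It follows that `K(x')^h(y')|K(x')^h` is
> unramified and that `(K(x')^h(y')|K,v)` is a henselized inertially generated function field.
> Since `vK(x')^h(y') = vF`, we find that `F|K(x')^h(y')` is immediate. But as proved above, the
> henselized inertially generated function field … does not admit any proper immediate algebraic
> extension. This yields `F = K(x')^h(y')`.

## Content (PROVED)

* `Kuhlmann2010FiniteExtensionInertiallyGenerated.of_parts :
  Kuhlmann2010NoImmediateExtensionRT → Kuhlmann2010HenselsLemma →
  Kuhlmann2010FiniteExtensionInertiallyGenerated`.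
* `Kuhlmann2010StabilityRankOneResidueTranscendental.of_henselsLemma` — hence (R4) for `K(t)`,
  `t` residue-transcendental, from Cor. 2.12, the reduction of pp. 18–19, Prop. 2.18,
  Cor. 4.2 / Prop. 3.1 and Hensel's Lemma.
* `Kuhlmann2010StabilityRankOneResidueTranscendental.of_ostrowski` — with Hensel's Lemma
  (`Kuhlmann2010HenselsLemma_holds`, `HenselsLemmaProofs.lean`) and Cor. 2.12 ⇐ Ostrowski
  (`Kuhlmann2010DefectlessOfResidueCharZero.of_ostrowski`, `DefectlessResidueCharZero.lean`)
  PROVED: the **trust base** of (R4), residue-transcendental case, is the Lemma of Ostrowski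
  (`Kuhlmann2010OstrowskiLemma`, §2.3 (9)), the reduction of pp. 18–19
  (`Kuhlmann2010TameTowerReduction`), Prop. 2.18 (`Kuhlmann2010DefectUnramifiedBaseChange`) and
  Cor. 4.2 / Prop. 3.1 (`Kuhlmann2010NormalDegreePDefectless`).

## Sources

* F.-V. Kuhlmann, Trans. AMS 362 (2010) = arXiv:1003.5678: §2.1 (Lemmas 2.1–2.3, 2.5), §2.5,
  §5, proof of Lemma 5.5 (p. 19) and p. 20.
-/

noncomputable section

open IsLocalRing Polynomial

namespace Literature.AlgebraicGeometry.Resolution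

universe u

variable {Ω : Type u} [Field Ω] (V : ValuationSubring Ω)

/-! ### Algebraicity over an intermediate field versus over its underlying subfield -/

/-- Algebraicity over an intermediate field `S` of `Ω|B` and over its underlying subfield
`S.toSubfield` are the same notion (the two algebra structures on `Ω` coincide definitionally).
[folklore] -/
theorem isAlgebraic_toSubfield_iff {B : Subfield Ω} (S : IntermediateField B Ω) (z : Ω) :
    IsAlgebraic S.toSubfield z ↔ IsAlgebraic S z :=
  Iff.rfl

/-! ### Lemma 5.5, Case II -/

/-- **Kuhlmann 2010, Lemma 5.5 as applied on p. 20, PROVED from the statement of p. 19 and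
Hensel's Lemma** (Case II of the printed proof, quoted in the module docstring): for `N` in the
class (generator `x`) over an algebraically closed `K` and `E ≥ N` finite: `E` is henselian
(Lemma 2.3) with `vE = vK` (Lemma 2.1) and `Ev` finite over `K(x)v = Kv(x̄)` (Lemma 2.5,
Lemma 2.2); a separating element `ξ` of `Ev|Kv` (`exists_separating_element`) lifts to a
residue-transcendental `x' ∈ E` with `K(x')` of rank one and `K(x')^h ≤ E`; a primitive element
`η` of `Ev|Kv(ξ)` lifts by Hensel's Lemma (`Kuhlmann2010HenselsLemma`,
`exists_root_lift_of_henselianLocalRing`) to `y ∈ E` with `[K(x')^h(y) : K(x')^h] = [Ev : Kv(ξ)]`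
and `K(x')^h(y)v = Ev`, so `K(x')^h(y)` is in the class and `E` is immediate and algebraic over
it (`isAlgebraic_adjoin_singleton_of_transcendental`), whence `E = K(x')^h(y)` by
`Kuhlmann2010NoImmediateExtensionRT`. [cite: Kuhlmann2010, Lemma 5.5 (proof, Case II) and Section 5, p. 20] -/
theorem Kuhlmann2010FiniteExtensionInertiallyGenerated.of_parts
    (hε : Kuhlmann2010NoImmediateExtensionRT.{u}) (hHL : Kuhlmann2010HenselsLemma.{u}) :
    Kuhlmann2010FiniteExtensionInertiallyGenerated.{u} := by
  intro Ω _ _ V p _ hp K N E hK hN hNE hpos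
  classical
  haveI : IsAlgClosed K := hK
  obtain ⟨x, hx, hr, hunr⟩ := id hN
  obtain ⟨hHN, hposHN, hdegHN, -, -⟩ := id hunr
  -- notation-free abbreviations: `Kx = K(x)`, `H = K(x)^h`
  have hKxH : (IntermediateField.adjoin K ({x} : Set Ω)).toSubfield ≤
      henselization V (IntermediateField.adjoin K ({x} : Set Ω)).toSubfield := le_henselization V _
  have hKKx : K ≤ (IntermediateField.adjoin K ({x} : Set Ω)).toSubfield := subfield_le_toSubfield _
  have hKE : K ≤ E := hKKx.trans (hKxH.trans (hHN.trans hNE))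
  have hxE : x ∈ E := hNE (hHN (hKxH (IntermediateField.subset_adjoin K ({x} : Set Ω) rfl)))
  -- Step A: `E` is algebraic over `N` and over `K(x)`, henselian, `vE = vK`, rank one
  have halgEN : ∀ a ∈ E, IsAlgebraic N a := fun a ha => isAlgebraic_of_relfinrank_pos hNE hpos ha
  have hNalgKx : ∀ w ∈ N, IsAlgebraic (IntermediateField.adjoin K ({x} : Set Ω)).toSubfield w :=
    fun w hw => isAlgebraic_trans_subfield hKxH
      (fun u hu => (isSeparable_of_mem_henselization V _ hu).isIntegral.isAlgebraic)
      (isAlgebraic_of_relfinrank_pos hHN hposHN hw)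
  have halgEKx : ∀ a ∈ E, IsAlgebraic (IntermediateField.adjoin K ({x} : Set Ω)).toSubfield a :=
    fun a ha => isAlgebraic_trans_subfield (hKxH.trans hHN) hNalgKx (halgEN a ha)
  have hEh : IsHenselianField E (V.comap (algebraMap E Ω)) :=
    IsHenselianField.of_subfield_algebraic V hNE halgEN hN.isHenselianField
  have hEH : HenselianLocalRing (V.comap (algebraMap E Ω)) := hHL E _ hEh
  have hvE : valueSubgroup E V = valueSubgroup K V := hN.valueSubgroup_eq_of_algebraic hK hNE halgEN
  have hrvE : IsRankOneValued V E := hN.isRankOneValued_of_algebraic hNE halgEN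
  obtain ⟨a₁, ha₁K, hva₁⟩ := hN.exists_one_lt_valuation
  -- Step B: the residue fields `Kv ≤ K(x)v = K(x)^h v ≤ Nv ≤ Ev`
  haveI hKbac : IsAlgClosed (residueSubfield K V) := isAlgClosed_residueSubfield (K := K) V
  have htrans : ∀ {r : ResidueField V}, Transcendental (resField V K) r →
      Transcendental (residueSubfield K V) r := fun {r} h => by
    have key : ∀ S : Subfield (ResidueField V), resField V K = S →
        Transcendental (resField V K) r → Transcendental S r := by
      rintro S rfl h'
      exact h'
    exact key _ (residueSubfield_subfield_eq_resField V K).symm h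
  have htrans' : ∀ {r : ResidueField V}, Transcendental (residueSubfield K V) r →
      Transcendental (resField V K) r := fun {r} h => by
    have key : ∀ S : Subfield (ResidueField V), residueSubfield K V = S →
        Transcendental (residueSubfield K V) r → Transcendental S r := by
      rintro S rfl h'
      exact h'
    exact key _ (residueSubfield_subfield_eq_resField V K) h
  have hxbtr : Transcendental (residueSubfield K V) (residue V ⟨x, hx.mem⟩) := htrans hx.2
  have hxbE : residue V ⟨x, hx.mem⟩ ∈ residueSubfield E V :=
    (mem_residueSubfield_iff E V _).mpr ⟨⟨x, hxE⟩, hx.mem, rfl⟩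
  have hKxb := residueSubfield_adjoin_eq_of_isResidueTranscendental V hx
  have hadjb : (IntermediateField.adjoin (residueSubfield K V)
      ({residue V ⟨x, hx.mem⟩} : Set (ResidueField V))).toSubfield =
      residueSubfield (IntermediateField.adjoin K ({x} : Set Ω)).toSubfield V := by
    rw [hKxb, IntermediateField.adjoin_toSubfield, range_algebraMap_subfield]
  have hHb : residueSubfield (henselization V (IntermediateField.adjoin K ({x} : Set Ω)).toSubfield) V =
      residueSubfield (IntermediateField.adjoin K ({x} : Set Ω)).toSubfield V :=
    (IsImmediateOver.valueSubgroup_eq_and_residueSubfield_eq V hKxH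
      (Kuhlmann2010HenselizationImmediate_holds Ω V _)).2
  -- `Ev` is finite over `K(x)v`
  have hposNbEb : 0 < Subfield.relfinrank (residueSubfield N V) (residueSubfield E V) :=
    (relIndex_mul_relfinrank_le_relfinrank V hNE hpos).2.1
  have hposKxbEb : 0 < Subfield.relfinrank
      (residueSubfield (IntermediateField.adjoin K ({x} : Set Ω)).toSubfield V) (residueSubfield E V) := by
    rw [← hHb, ← Subfield.relfinrank_mul_relfinrank (residueSubfield_subfield_mono (V := V) hHN)
      (residueSubfield_subfield_mono hNE), ← hdegHN]
    exact Nat.mul_pos hposHN hposNbEb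
  -- a separating element `ξ` of `Ev|Kv`
  obtain ⟨ξ, hξE, hξtr, hξle, hξpos, hξsep⟩ := exists_separating_element
    (B := residueSubfield K V) (L := residueSubfield E V) (residueSubfield_subfield_mono hKE)
    (t := residue V ⟨x, hx.mem⟩) hxbE hxbtr
    (by rw [hadjb]; exact residueSubfield_subfield_mono (hKxH.trans (hHN.trans hNE)))
    (by rw [hadjb]; exact hposKxbEb)
  -- Step C: lift `ξ` to `x' ∈ E`; `K(x')` has rank one; `H' = K(x')^h ≤ E`
  obtain ⟨c, hcV, hcξ⟩ := (mem_residueSubfield_iff E V ξ).mp hξE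
  have hcξ' : residue V ⟨(c : Ω), hcV⟩ = ξ := hcξ
  have hx' : IsResidueTranscendental V K (c : Ω) := ⟨hcV, htrans' (hcξ'.symm ▸ hξtr)⟩
  have hKKx' : K ≤ (IntermediateField.adjoin K ({(c : Ω)} : Set Ω)).toSubfield :=
    subfield_le_toSubfield _
  have hKx'E : (IntermediateField.adjoin K ({(c : Ω)} : Set Ω)).toSubfield ≤ E := by
    have h1 : IntermediateField.adjoin K ({(c : Ω)} : Set Ω) ≤ Subfield.extendScalars hKE :=
      IntermediateField.adjoin_le_iff.mpr (Set.singleton_subset_iff.mpr c.2)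
    exact fun z hz => h1 hz
  have hrKx' : IsRankOne V (IntermediateField.adjoin K ({(c : Ω)} : Set Ω)).toSubfield :=
    isRankOne_of_isRankOneValued V (hrvE.of_le hKx'E ⟨a₁, hKKx' ha₁K, hva₁⟩)
  have hH'E : henselization V (IntermediateField.adjoin K ({(c : Ω)} : Set Ω)).toSubfield ≤ E :=
    henselization_le_of_isHenselianField V _ hKx'E hEh
  have hH'C : IsHenselizedInertiallyGeneratedRT V K
      (henselization V (IntermediateField.adjoin K ({(c : Ω)} : Set Ω)).toSubfield) :=
    isHenselizedInertiallyGeneratedRT_henselization hx' hrKx'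
  have hvH' := hH'C.valueSubgroup_eq
  have hKx'H' : (IntermediateField.adjoin K ({(c : Ω)} : Set Ω)).toSubfield ≤
      henselization V (IntermediateField.adjoin K ({(c : Ω)} : Set Ω)).toSubfield := le_henselization V _
  -- residue field of `H'`: `H'v = K(x')v = Kv(ξ)`
  have hKx'b := residueSubfield_adjoin_eq_of_isResidueTranscendental V hx'
  have hH'b : residueSubfield (henselization V (IntermediateField.adjoin K ({(c : Ω)} : Set Ω)).toSubfield) V =
      residueSubfield (IntermediateField.adjoin K ({(c : Ω)} : Set Ω)).toSubfield V :=
    (IsImmediateOver.valueSubgroup_eq_and_residueSubfield_eq V hKx'H'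
      (Kuhlmann2010HenselizationImmediate_holds Ω V _)).2
  have hadjξ : (IntermediateField.adjoin (residueSubfield K V) ({ξ} : Set (ResidueField V))).toSubfield =
      residueSubfield (henselization V (IntermediateField.adjoin K ({(c : Ω)} : Set Ω)).toSubfield) V := by
    rw [hH'b, hKx'b, IntermediateField.adjoin_toSubfield, range_algebraMap_subfield]
    exact congrArg _ (congrArg _ (congrArg _ hcξ'.symm))
  -- Step D: a primitive element `η` of `Ev|Kv(ξ)` and its Hensel lift `y`
  -- `kξ = Kv(ξ)` as an intermediate field, `Ev` as an intermediate field over it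
  have hKbEb : residueSubfield K V ≤ residueSubfield E V := residueSubfield_subfield_mono hKE
  have hkξMb : IntermediateField.adjoin (residueSubfield K V) ({ξ} : Set (ResidueField V)) ≤
      Subfield.extendScalars hKbEb := fun z hz => hξle hz
  haveI hfinEb : FiniteDimensional (IntermediateField.adjoin (residueSubfield K V) ({ξ} : Set (ResidueField V)))
      (IntermediateField.extendScalars hkξMb) := by
    have h1 := Subfield.relfinrank_eq_finrank_of_le hξle
    rw [h1] at hξpos
    exact Module.finite_of_finrank_pos hξpos
  haveI hsepEb : Algebra.IsSeparable
      (IntermediateField.adjoin (residueSubfield K V) ({ξ} : Set (ResidueField V)))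
      (IntermediateField.extendScalars hkξMb) :=
    ⟨fun z => IsSeparable.tower_bot (hξsep (z : ResidueField V) z.2)⟩
  obtain ⟨η, hη⟩ := Field.exists_primitive_element
    (IntermediateField.adjoin (residueSubfield K V) ({ξ} : Set (ResidueField V)))
    (IntermediateField.extendScalars hkξMb)
  have hηint : IsIntegral (IntermediateField.adjoin (residueSubfield K V) ({ξ} : Set (ResidueField V))) η :=
    (Algebra.IsSeparable.isSeparable _ η).isIntegral
  -- the iso `kξ ≃ H'v` and the transported minimal polynomial
  let e : IntermediateField.adjoin (residueSubfield K V) ({ξ} : Set (ResidueField V)) ≃+*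
      residueSubfield (henselization V (IntermediateField.adjoin K ({(c : Ω)} : Set Ω)).toSubfield) V :=
    RingEquiv.subfieldCongr hadjξ
  have he : ∀ w, ((e w : residueSubfield (henselization V
      (IntermediateField.adjoin K ({(c : Ω)} : Set Ω)).toSubfield) V) : ResidueField V) = (w : ResidueField V) :=
    fun _ => rfl
  have hecomp : (algebraMap (residueSubfield (henselization V
      (IntermediateField.adjoin K ({(c : Ω)} : Set Ω)).toSubfield) V) (ResidueField V)).comp e.toRingHom =
      algebraMap (IntermediateField.adjoin (residueSubfield K V) ({ξ} : Set (ResidueField V))) (ResidueField V) :=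
    RingHom.ext fun _ => rfl
  set gbar := (minpoly _ η).map e.toRingHom with hgbar
  have hgmon : gbar.Monic := (minpoly.monic hηint).map _
  have hgirr : Irreducible gbar :=
    (MulEquiv.irreducible_iff (Polynomial.mapEquiv e)).mpr (minpoly.irreducible hηint)
  have hgdeg : gbar.natDegree = (minpoly _ η).natDegree := natDegree_map_eq_of_injective e.injective _
  have hηE : ((η : ResidueField V)) ∈ residueSubfield E V := η.2
  have heval₂ : ∀ q : Polynomial (IntermediateField.adjoin (residueSubfield K V) ({ξ} : Set (ResidueField V))),
      aeval (η : ResidueField V) (q.map e.toRingHom) =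
        algebraMap (IntermediateField.extendScalars hkξMb) (ResidueField V) (aeval η q) := fun q => by
    rw [aeval_def, eval₂_map, hecomp, ← aeval_def]
    change aeval (algebraMap (IntermediateField.extendScalars hkξMb) (ResidueField V) η) q = _
    rw [aeval_algebraMap_apply]
  have hroot : aeval (η : ResidueField V) gbar = 0 := by
    rw [hgbar, heval₂, minpoly.aeval, map_zero]
  have hsimple : aeval (η : ResidueField V) (derivative gbar) ≠ 0 := by
    rw [hgbar, derivative_map, heval₂]
    exact (_root_.map_ne_zero_iff _
      (algebraMap (IntermediateField.extendScalars hkξMb) (ResidueField V)).injective).mpr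
      ((Algebra.IsSeparable.isSeparable _ η).aeval_derivative_ne_zero (minpoly.aeval _ η))
  -- Hensel's Lemma
  obtain ⟨g, y, hyV, hgmon', hgirr', hgdeg', hyE, hyg, hyres⟩ :=
    exists_root_lift_of_henselianLocalRing V hH'E hEH gbar hgmon hgirr hηE hroot hsimple
  -- Step E: `F' = H'(y)`
  have hH'F' : henselization V (IntermediateField.adjoin K ({(c : Ω)} : Set Ω)).toSubfield ≤
      (IntermediateField.adjoin (henselization V (IntermediateField.adjoin K ({(c : Ω)} : Set Ω)).toSubfield)
        ({y} : Set Ω)).toSubfield := subfield_le_toSubfield _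
  have hyF' : y ∈ (IntermediateField.adjoin (henselization V
      (IntermediateField.adjoin K ({(c : Ω)} : Set Ω)).toSubfield) ({y} : Set Ω)).toSubfield :=
    IntermediateField.subset_adjoin _ _ rfl
  have hF'E : (IntermediateField.adjoin (henselization V
      (IntermediateField.adjoin K ({(c : Ω)} : Set Ω)).toSubfield) ({y} : Set Ω)).toSubfield ≤ E := by
    have h1 : IntermediateField.adjoin (henselization V
        (IntermediateField.adjoin K ({(c : Ω)} : Set Ω)).toSubfield) ({y} : Set Ω) ≤
        Subfield.extendScalars hH'E :=
      IntermediateField.adjoin_le_iff.mpr (Set.singleton_subset_iff.mpr hyE)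
    exact fun z hz => h1 hz
  -- degree `[F' : H'] = deg g`
  have hyint : IsIntegral (henselization V (IntermediateField.adjoin K ({(c : Ω)} : Set Ω)).toSubfield) y :=
    ⟨g, hgmon', hyg⟩
  have hmin : g = minpoly _ y := minpoly.eq_of_irreducible_of_monic hgirr' hyg hgmon'
  have hrelF' : Subfield.relfinrank (henselization V (IntermediateField.adjoin K ({(c : Ω)} : Set Ω)).toSubfield)
      (IntermediateField.adjoin (henselization V (IntermediateField.adjoin K ({(c : Ω)} : Set Ω)).toSubfield)
        ({y} : Set Ω)).toSubfield = g.natDegree := by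
    rw [relfinrank_toSubfield_eq_finrank, IntermediateField.adjoin.finrank hyint, ← hmin]
  -- residue field `F'v = Ev`
  have hF'b : residueSubfield (IntermediateField.adjoin (henselization V
      (IntermediateField.adjoin K ({(c : Ω)} : Set Ω)).toSubfield) ({y} : Set Ω)).toSubfield V =
      residueSubfield E V := by
    refine le_antisymm (residueSubfield_subfield_mono hF'E) fun r hr => ?_
    -- `Ev = Kv(ξ)(η)` and `Kv(ξ) = H'v ≤ F'v`, `η̄ = ȳ ∈ F'v`
    have hr' : (⟨r, hr⟩ : IntermediateField.extendScalars hkξMb) ∈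
        (⊤ : IntermediateField (IntermediateField.adjoin (residueSubfield K V) ({ξ} : Set (ResidueField V)))
          (IntermediateField.extendScalars hkξMb)) := IntermediateField.mem_top
    rw [← hη] at hr'
    have hr'' := (IntermediateField.mem_lift (⟨r, hr⟩ : IntermediateField.extendScalars hkξMb)).mpr hr'
    rw [IntermediateField.lift_adjoin, Set.image_singleton] at hr''
    change r ∈ (IntermediateField.adjoin _ ({(η : ResidueField V)} : Set (ResidueField V))).toSubfield at hr''
    rw [IntermediateField.adjoin_toSubfield, range_algebraMap_intermediateField] at hr''
    refine Subfield.closure_le.mpr ?_ hr''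
    rintro u (hu | hu)
    · have hu' : u ∈ (IntermediateField.adjoin (residueSubfield K V) ({ξ} : Set (ResidueField V))).toSubfield := hu
      rw [hadjξ] at hu'
      exact residueSubfield_subfield_mono hH'F' hu'
    · rw [Set.mem_singleton_iff] at hu
      subst hu
      rw [← hyres]
      exact (mem_residueSubfield_iff _ V _).mpr ⟨⟨y, hyF'⟩, hyV, rfl⟩
  -- residue degree `[F'v : H'v] = [Ev : Kv(ξ)] = deg ḡ = deg g`
  have hresdeg : Subfield.relfinrank
      (residueSubfield (henselization V (IntermediateField.adjoin K ({(c : Ω)} : Set Ω)).toSubfield) V)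
      (residueSubfield (IntermediateField.adjoin (henselization V
        (IntermediateField.adjoin K ({(c : Ω)} : Set Ω)).toSubfield) ({y} : Set Ω)).toSubfield V) =
      g.natDegree := by
    rw [hF'b, ← hadjξ, Subfield.relfinrank_eq_finrank_of_le hξle, hgdeg', hgdeg,
      ← IntermediateField.adjoin.finrank hηint, hη, IntermediateField.finrank_top']
    rfl
  -- `F'` is unramified over `H'`
  have hunr' : IsUnramifiedOver V (henselization V (IntermediateField.adjoin K ({(c : Ω)} : Set Ω)).toSubfield)
      (IntermediateField.adjoin (henselization V (IntermediateField.adjoin K ({(c : Ω)} : Set Ω)).toSubfield)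
        ({y} : Set Ω)).toSubfield := by
    refine ⟨hH'F', ?_, ?_, ?_, ?_⟩
    · rw [hrelF', hgdeg', hgdeg]
      exact minpoly.natDegree_pos hηint
    · rw [hrelF', hresdeg]
    · intro r hr
      rw [hF'b] at hr
      exact isSeparable_of_ringHom_comp_eq e.toRingHom hecomp (hξsep r hr)
    · refine le_antisymm ?_ (valueSubgroup_subfield_mono hH'F')
      rw [hvH', ← hvE]
      exact valueSubgroup_subfield_mono hF'E
  have hF'C : IsHenselizedInertiallyGeneratedRT V K (IntermediateField.adjoin (henselization V
      (IntermediateField.adjoin K ({(c : Ω)} : Set Ω)).toSubfield) ({y} : Set Ω)).toSubfield :=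
    ⟨(c : Ω), hx', hrKx', hunr'⟩
  -- Step F: `E` is immediate and algebraic over `F'`, hence `E = F'`
  have hKx'F' : (IntermediateField.adjoin K ({(c : Ω)} : Set Ω)).toSubfield ≤
      (IntermediateField.adjoin (henselization V (IntermediateField.adjoin K ({(c : Ω)} : Set Ω)).toSubfield)
        ({y} : Set Ω)).toSubfield := hKx'H'.trans hH'F'
  have halgEF' : ∀ a ∈ E, IsAlgebraic (IntermediateField.adjoin (henselization V
      (IntermediateField.adjoin K ({(c : Ω)} : Set Ω)).toSubfield) ({y} : Set Ω)).toSubfield a := by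
    intro a ha
    refine isAlgebraic_of_subfield_le hKx'F' ((isAlgebraic_toSubfield_iff _ _).mpr ?_)
    exact isAlgebraic_adjoin_singleton_of_transcendental hKE hxE c.2 hx'.transcendental
      (fun z hz => (isAlgebraic_toSubfield_iff _ z).mp (halgEKx z hz)) a ha
  have himm : IsImmediateOver V (IntermediateField.adjoin (henselization V
      (IntermediateField.adjoin K ({(c : Ω)} : Set Ω)).toSubfield) ({y} : Set Ω)).toSubfield E := by
    refine ⟨fun a ha ha0 => ?_, ?_⟩
    · have hva : V.valuation a ≠ 0 := (Valuation.ne_zero_iff _).mpr ha0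
      have hmem : Units.mk0 _ hva ∈ valueSubgroup E V :=
        (mem_valueSubgroup_iff E V _).mpr ⟨⟨a, ha⟩, fun h => ha0 (congrArg Subtype.val h), rfl⟩
      rw [hvE] at hmem
      obtain ⟨d, -, hd⟩ := (mem_valueSubgroup_iff K V _).mp hmem
      refine ⟨d, hKKx'.trans hKx'F' d.2, ?_⟩
      rw [Units.val_mk0] at hd
      exact hd
    · rw [← residueSubfield_subfield_eq_resField, ← residueSubfield_subfield_eq_resField, hF'b]
  have hEF' := hε Ω V p hp K _ E hK hF'C hF'E halgEF' himm
  rw [hEF']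
  exact hF'C

/-- **(R4) for `K(t)`, `t` residue-transcendental, with Lemma 5.5 discharged**: from Cor. 2.12,
the reduction of pp. 18–19 (with Lemma 2.27), Prop. 2.18, Cor. 4.2 / Prop. 3.1 and Hensel's
Lemma for henselian fields (§1.1) — Thm. 2.14, Lemma 2.2, §1.1 (henselization is henselian), the
displayed statement of p. 19 and Lemma 5.5 being PROVED from these. [cite: Kuhlmann2010, Section 5, Lemma 5.4 (R4) and proof of (R4) (pp. 18–20)] -/
theorem Kuhlmann2010StabilityRankOneResidueTranscendental.of_henselsLemma
    (h212 : Kuhlmann2010DefectlessOfResidueCharZero.{u})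
    (hα : Kuhlmann2010TameTowerReduction.{u})
    (hγ : Kuhlmann2010DefectUnramifiedBaseChange.{u})
    (hδ : Kuhlmann2010NormalDegreePDefectless.{u})
    (hHL : Kuhlmann2010HenselsLemma.{u}) :
    Kuhlmann2010StabilityRankOneResidueTranscendental.{u} :=
  Kuhlmann2010StabilityRankOneResidueTranscendental.of_namedFacts h212 hα hγ hδ
    (Kuhlmann2010FiniteExtensionInertiallyGenerated.of_parts
      (Kuhlmann2010NoImmediateExtensionRT.of_parts hα hγ hδ) hHL)

/-- **The trust base of (R4) for `K(t)`, `t` residue-transcendental**: the Lemma of Ostrowski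
(§2.3 (9)), the reduction of pp. 18–19 to a tower of normal extensions of degree `p` over a
finite unramified extension (with Lemma 2.27), Prop. 2.18, and Cor. 4.2 / Prop. 3.1 — everything
else on pp. 18–20 (Thm. 2.14, Lemma 2.2, §1.1 with Hensel's Lemma, Cor. 2.12, Lemma 2.13,
Lemma 2.27 as used, the statement of p. 19, Lemma 5.5, the induction of p. 20) being PROVED.
[cite: Kuhlmann2010, Section 5, Lemma 5.4 (R4) and proof of (R4) (pp. 18–20)] -/
theorem Kuhlmann2010StabilityRankOneResidueTranscendental.of_ostrowski
    (hO : Kuhlmann2010OstrowskiLemma.{u})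
    (hα : Kuhlmann2010TameTowerReduction.{u})
    (hγ : Kuhlmann2010DefectUnramifiedBaseChange.{u})
    (hδ : Kuhlmann2010NormalDegreePDefectless.{u}) :
    Kuhlmann2010StabilityRankOneResidueTranscendental.{u} :=
  Kuhlmann2010StabilityRankOneResidueTranscendental.of_henselsLemma
    (Kuhlmann2010DefectlessOfResidueCharZero.of_ostrowski hO) hα hγ hδ
    Kuhlmann2010HenselsLemma_holds

end Literature.AlgebraicGeometry.Resolution
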